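import Mathlib.LinearAlgebra.FiniteDimensional.Lemmas
import Mathlib.LinearAlgebra.Eigenspace.Basic
import Mathlib.LinearAlgebra.Pi
import Mathlib.Analysis.Real.Sqrt
import Literature.Probability.RandomGraphs.LowDegree
import Literature.Computability.Complexity.BlockSensitivity
import HarnessLib

/-!
# Huang's signed hypercube matrix and the eigenvector lemma

H. Huang, *Induced subgraphs of hypercubes and a proof of the Sensitivity Conjecture*, Ann. of
Math. 190 (2019), **Lemma 2.2** (the matrix `A_n`, "`A_n² = nI` … the eigenvalues of `A_n` are
`√n` of multiplicity `2^{n-1}`, and `-√n` of multiplicity `2^{n-1}`") and the linear-algebra step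
of the proof of Thm. 1.1, in the form used by Aaronson–Ben-David–Kothari–Rao–Tal (STOC 2021, §3,
proof of their Thm. "Huang": "the subspace of eigenvectors for `B_n` with eigenvalue `√n` is of
dimension `2ⁿ/2`. Using `|V₁| < 2ⁿ/2`, there must exist a nonzero eigenvector for `B_n` with
eigenvalue `√n` that vanishes on `V₁`").

We work on the whole cube `{0,1}ᴺ` with a set of directions `S₀ ⊆ [N]` (`|S₀| = n`): the signed
adjacency operator (`huangOp S₀`) is
`(B v)(x) = ∑_{i ∈ S₀} ε(x,i) v(x^i)`, `ε(x,i) = ∏_{j ∈ S₀, j < i} (-1)^{x_j}` (`huangSign`, the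
explicit form of Huang's recursive signing `B_i = [[B_{i-1}, I], [I, -B_{i-1}]]`), `x^i = flipBlock x {i}`.

* `huangOp_huangOp`: `B² = n · id` (off-diagonal paths cancel in pairs);
* `huangOp_walshMul`: `B ∘ W = - W ∘ B` for `W` = multiplication by the character `χ_{S₀}`
  (the hypercube restricted to directions in `S₀` is bipartite), whence `eigPlus ≃ eigMinus`
  and `finrank eigPlus = 2^{N-1}` (`finrank_eigPlus`; the tree's substitute for "observing that
  the trace of `B_n` is `0`");
* `exists_eigenvector_vanishing_off`: for `|V| > 2^{N-1}` (this `V` is ABKRT's larger class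
  `V₀`) there is `v ≠ 0` supported in `V` — i.e. vanishing on `V₁ = Vᶜ` — with `B v = √n · v`
  (ABKRT's dimension count, `finrank_sup_add_finrank_inf_eq`; Huang's own printed proof goes
  through Cauchy interlacing instead).

This is the combinatorial-linear-algebra half of `deg(f) ≤ λ(f)²` (file `HuangDegree.lean`),
an ingredient of `D(f) = O(Q(f)⁴)`. Mathlib has Huang's theorem only in `Archive`
(`Archive/Sensitivity.lean`, not importable). Reused: characters `walsh`, `sgn`
(`Literature.Probability.RandomGraphs.LowDegree`), `flipBlock` (`BlockSensitivity.lean`),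
Mathlib's eigenspaces `Module.End.eigenspace` (`eigPlus`, `eigMinus` are abbreviations) and
extension by zero `Function.ExtendByZero.linearMap` (functions supported in `V`). The lemma
`sgn_not` is textually the same as `ACForm.sgn_not` of `ACFourierTails.lean` (a 2000-line file
not worth importing here; a librarian may move one copy next to `sgn`).

## References

* H. Huang, Ann. of Math. 190 (2019) 949–955 (arXiv:1907.00847), Lemma 2.2 and proof of
  Thm. 1.1 [Huang2019].
* S. Aaronson, S. Ben-David, R. Kothari, S. Rao, A. Tal, STOC 2021 (arXiv:2010.12629), §3
  (proof of Thm. "Huang", eq. for `B_n`) [AaronsonBenDavidKothariRaoTal2021].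
-/

noncomputable section

namespace Literature.Computability.Complexity

open Finset Module Literature.Probability.RandomGraphs.LowDegree

variable {N : ℕ}

/-! ### Single-bit flips `x^i = flipBlock x {i}` -/

/-- `(x^i)_i = ¬x_i`. [folklore] -/
@[simp] theorem flipBlock_singleton_apply_self (x : Fin N → Bool) (i : Fin N) :
    flipBlock x {i} i = !x i :=
  flipBlock_apply_of_mem (Finset.mem_singleton_self i)

/-- `(x^i)_j = x_j` for `j ≠ i`. [folklore] -/
@[simp] theorem flipBlock_singleton_apply_of_ne (x : Fin N → Bool) {i j : Fin N} (h : j ≠ i) :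
    flipBlock x {i} j = x j :=
  flipBlock_apply_of_not_mem (by simpa using h)

/-- `(x^i)^i = x`. [folklore] -/
@[simp] theorem flipBlock_singleton_flipBlock_singleton (x : Fin N → Bool) (i : Fin N) :
    flipBlock (flipBlock x {i}) {i} = x := by
  rw [flipBlock_flipBlock_of_subset subset_rfl]; simp

/-- Flips commute: `(x^A)^B = (x^B)^A`. [folklore] -/
theorem flipBlock_comm (x : Fin N → Bool) (A B : Finset (Fin N)) :
    flipBlock (flipBlock x A) B = flipBlock (flipBlock x B) A := by
  funext j
  by_cases hA : j ∈ A <;> by_cases hB : j ∈ B <;> simp [flipBlock, hA, hB]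

/-- Flipping bit `i` is an involution of the cube, so sums may be reindexed along it. [folklore] -/
theorem sum_flipBlock_singleton {α : Type*} [AddCommMonoid α] (i : Fin N)
    (g : (Fin N → Bool) → α) : ∑ x, g (flipBlock x {i}) = ∑ x, g x :=
  Function.Bijective.sum_comp
    (Function.Involutive.bijective fun x => flipBlock_singleton_flipBlock_singleton x i) g

/-! ### Characters under single-bit flips -/

/-- `(-1)^{¬b} = -(-1)^b` (same statement as `ACForm.sgn_not` in `ACFourierTails.lean`, kept
local to avoid that import). [folklore] -/
@[simp] theorem sgn_not (b : Bool) : sgn (!b) = -sgn b := by cases b <;> simp [sgn]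

/-- `χ_T(x)² = 1`. [folklore] -/
theorem walsh_mul_self (T : Finset (Fin N)) (x : Fin N → Bool) : walsh T x * walsh T x = 1 := by
  unfold walsh
  rw [← Finset.prod_mul_distrib]
  exact Finset.prod_eq_one fun i _ => sgn_mul_self _

/-- `|χ_T(x)| = 1`. [folklore] -/
theorem abs_walsh (T : Finset (Fin N)) (x : Fin N → Bool) : |walsh T x| = 1 := by
  have h := walsh_mul_self T x
  have h2 : |walsh T x| * |walsh T x| = 1 := by rw [← abs_mul, h, abs_one]
  nlinarith [abs_nonneg (walsh T x)]

/-- Flipping a bit inside `T` flips the sign of `χ_T`. [cite: AaronsonBenDavidKothariRaoTal2021,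
§3 (proof of Thm. "Huang": "Parity_n(x) ≠ Parity_n(x ⊕ e_i)")] -/
theorem walsh_flipBlock_singleton_of_mem {T : Finset (Fin N)} {i : Fin N} (hi : i ∈ T)
    (x : Fin N → Bool) : walsh T (flipBlock x {i}) = -walsh T x := by
  unfold walsh
  rw [← Finset.mul_prod_erase T _ hi, ← Finset.mul_prod_erase T (fun j => sgn (x j)) hi]
  rw [flipBlock_singleton_apply_self, sgn_not, neg_mul]
  congr 2
  exact Finset.prod_congr rfl fun j hj =>
    by rw [flipBlock_singleton_apply_of_ne x (Finset.ne_of_mem_erase hj)]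

/-- Flipping a bit outside `T` leaves `χ_T` unchanged. [folklore] -/
theorem walsh_flipBlock_singleton_of_not_mem {T : Finset (Fin N)} {i : Fin N} (hi : i ∉ T)
    (x : Fin N → Bool) : walsh T (flipBlock x {i}) = walsh T x := by
  unfold walsh
  exact Finset.prod_congr rfl fun j hj => by
    rw [flipBlock_singleton_apply_of_ne x (ne_of_mem_of_not_mem hj hi)]

/-! ### Huang's signing and the operator `B` -/

/-- Huang's signing of the hypercube edge `(x, x^i)`: `ε(x,i) = ∏_{j ∈ S₀, j < i} (-1)^{x_j}`,
the product running over the coordinates of `S₀` BELOW `i` — the explicit form of the recursive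
`B_i = [[B_{i-1}, I], [I, -B_{i-1}]]` with the smallest index as the outermost block (coordinate
order reversed relative to Huang's `A_n`; immaterial, `B² = n·id` is proved below). [cite:
Huang2019, Lemma 2.2] -/
def huangSign (S₀ : Finset (Fin N)) (x : Fin N → Bool) (i : Fin N) : ℝ :=
  walsh (S₀.filter (· < i)) x

/-- `ε(x,i)² = 1`. [folklore] -/
theorem huangSign_mul_self (S₀ : Finset (Fin N)) (x : Fin N → Bool) (i : Fin N) :
    huangSign S₀ x i * huangSign S₀ x i = 1 :=
  walsh_mul_self _ _

/-- `|ε(x,i)| = 1`. [folklore] -/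
theorem abs_huangSign (S₀ : Finset (Fin N)) (x : Fin N → Bool) (i : Fin N) :
    |huangSign S₀ x i| = 1 :=
  abs_walsh _ _

/-- Flipping bit `i` itself does not change `ε(·, i)`. [cite: Huang2019, Lemma 2.2 (proof)] -/
theorem huangSign_flipBlock_self (S₀ : Finset (Fin N)) (x : Fin N → Bool) (i : Fin N) :
    huangSign S₀ (flipBlock x {i}) i = huangSign S₀ x i :=
  walsh_flipBlock_singleton_of_not_mem (by simp) x

/-- Flipping a bit `i ∈ S₀` below `k` flips `ε(·, k)`. [cite: Huang2019, Lemma 2.2 (proof)] -/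
theorem huangSign_flipBlock_of_lt (S₀ : Finset (Fin N)) (x : Fin N → Bool) {i k : Fin N}
    (hi : i ∈ S₀) (hik : i < k) : huangSign S₀ (flipBlock x {i}) k = -huangSign S₀ x k :=
  walsh_flipBlock_singleton_of_mem (by simp [hi, hik]) x

/-- Flipping a bit `k` not below `i` leaves `ε(·, i)` unchanged. [cite: Huang2019, Lemma 2.2
(proof)] -/
theorem huangSign_flipBlock_of_not_lt (S₀ : Finset (Fin N)) (x : Fin N → Bool) {i k : Fin N}
    (hki : ¬ k < i) : huangSign S₀ (flipBlock x {k}) i = huangSign S₀ x i :=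
  walsh_flipBlock_singleton_of_not_mem (by simp [hki]) x

/-- **Huang's signed adjacency operator** on real functions on the cube, along the directions
`S₀`: `(B v)(x) = ∑_{i ∈ S₀} ε(x,i) v(x^i)`. [cite: Huang2019, Lemma 2.2] -/
def huangOp (S₀ : Finset (Fin N)) : ((Fin N → Bool) → ℝ) →ₗ[ℝ] ((Fin N → Bool) → ℝ) where
  toFun v x := ∑ i ∈ S₀, huangSign S₀ x i * v (flipBlock x {i})
  map_add' u v := by
    funext x
    simp only [Pi.add_apply, mul_add, Finset.sum_add_distrib]
  map_smul' c v := by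
    funext x
    simp only [Pi.smul_apply, smul_eq_mul, RingHom.id_apply, Finset.mul_sum]
    exact Finset.sum_congr rfl fun i _ => by ring

/-- Unfolding `huangOp`. [cite: Huang2019, Lemma 2.2] -/
theorem huangOp_apply (S₀ : Finset (Fin N)) (v : (Fin N → Bool) → ℝ) (x : Fin N → Bool) :
    huangOp S₀ v x = ∑ i ∈ S₀, huangSign S₀ x i * v (flipBlock x {i}) := rfl

/-- **`B² = n · id`** (Huang's Lemma 2.2: "`A_n² = nI`"): the two paths `x → x^i → x^{ik}` and
`x → x^k → x^{ik}` carry opposite signs. [cite: Huang2019, Lemma 2.2] -/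
theorem huangOp_huangOp (S₀ : Finset (Fin N)) (v : (Fin N → Bool) → ℝ) :
    huangOp S₀ (huangOp S₀ v) = (S₀.card : ℝ) • v := by
  classical
  funext x
  simp only [huangOp_apply, Pi.smul_apply, smul_eq_mul, Finset.mul_sum]
  -- the summand and its antisymmetry off the diagonal
  set c : Fin N → Fin N → ℝ := fun i k =>
    huangSign S₀ x i * (huangSign S₀ (flipBlock x {i}) k *
      v (flipBlock (flipBlock x {i}) {k})) with hc
  have hanti : ∀ i ∈ S₀, ∀ k ∈ S₀, i ≠ k → c i k = -c k i := by
    intro i hi k hk hik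
    simp only [hc]
    rw [flipBlock_comm x {k} {i}]
    rcases lt_or_gt_of_ne hik with h | h
    · rw [huangSign_flipBlock_of_lt S₀ x hi h, huangSign_flipBlock_of_not_lt S₀ x h.not_gt]
      ring
    · rw [huangSign_flipBlock_of_lt S₀ x hk h, huangSign_flipBlock_of_not_lt S₀ x h.not_gt]
      ring
  have hdiag : ∀ i, c i i = v x := by
    intro i
    simp only [hc]
    rw [huangSign_flipBlock_self, flipBlock_singleton_flipBlock_singleton, ← mul_assoc,
      huangSign_mul_self, one_mul]
  -- split the double sum into diagonal and off-diagonal parts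
  change ∑ i ∈ S₀, ∑ k ∈ S₀, c i k = (S₀.card : ℝ) * v x
  have hsplit : ∀ i k, c i k = (if i = k then c i k else 0) + (if i = k then 0 else c i k) := by
    intro i k; split_ifs <;> simp
  have hoff : ∑ i ∈ S₀, ∑ k ∈ S₀, (if i = k then 0 else c i k) = 0 := by
    set O := ∑ i ∈ S₀, ∑ k ∈ S₀, (if i = k then 0 else c i k) with hO
    have hneg : O = -O := by
      calc O = ∑ i ∈ S₀, ∑ k ∈ S₀, (if i = k then 0 else -c k i) := by
            refine Finset.sum_congr rfl fun i hi => Finset.sum_congr rfl fun k hk => ?_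
            split_ifs with h
            · rfl
            · exact hanti i hi k hk h
        _ = -∑ i ∈ S₀, ∑ k ∈ S₀, (if i = k then 0 else c k i) := by
            rw [← Finset.sum_neg_distrib]
            refine Finset.sum_congr rfl fun i _ => ?_
            rw [← Finset.sum_neg_distrib]
            refine Finset.sum_congr rfl fun k _ => ?_
            split_ifs <;> simp
        _ = -∑ k ∈ S₀, ∑ i ∈ S₀, (if i = k then 0 else c k i) := by rw [Finset.sum_comm]
        _ = -O := by
            rw [hO]
            congr 1
            refine Finset.sum_congr rfl fun k _ => Finset.sum_congr rfl fun i _ => ?_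
            simp only [eq_comm]
    linarith
  calc ∑ i ∈ S₀, ∑ k ∈ S₀, c i k
      = ∑ i ∈ S₀, ∑ k ∈ S₀, ((if i = k then c i k else 0) + (if i = k then 0 else c i k)) :=
        Finset.sum_congr rfl fun i _ => Finset.sum_congr rfl fun k _ => hsplit i k
    _ = ∑ i ∈ S₀, ∑ k ∈ S₀, (if i = k then c i k else 0) +
          ∑ i ∈ S₀, ∑ k ∈ S₀, (if i = k then 0 else c i k) := by
        rw [← Finset.sum_add_distrib]
        exact Finset.sum_congr rfl fun i _ => Finset.sum_add_distrib
    _ = ∑ i ∈ S₀, c i i := by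
        rw [hoff, add_zero]
        refine Finset.sum_congr rfl fun i hi => ?_
        rw [Finset.sum_ite_eq, if_pos hi]
    _ = (S₀.card : ℝ) * v x := by
        rw [Finset.sum_congr rfl fun i _ => hdiag i, Finset.sum_const, nsmul_eq_mul]

/-- Multiplication by the character `χ_{S₀}` (the parity of the `S₀`-coordinates), a linear
involution. [cite: AaronsonBenDavidKothariRaoTal2021, §3 (proof of Thm. "Huang")] -/
def walshMul (S₀ : Finset (Fin N)) : ((Fin N → Bool) → ℝ) →ₗ[ℝ] ((Fin N → Bool) → ℝ) where
  toFun v x := walsh S₀ x * v x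
  map_add' u v := by funext x; simp only [Pi.add_apply]; ring
  map_smul' c v := by funext x; simp only [Pi.smul_apply, smul_eq_mul, RingHom.id_apply]; ring

/-- Unfolding `walshMul`. [folklore] -/
theorem walshMul_apply (S₀ : Finset (Fin N)) (v : (Fin N → Bool) → ℝ) (x : Fin N → Bool) :
    walshMul S₀ v x = walsh S₀ x * v x := rfl

/-- `W² = id`. [folklore] -/
theorem walshMul_walshMul (S₀ : Finset (Fin N)) (v : (Fin N → Bool) → ℝ) :
    walshMul S₀ (walshMul S₀ v) = v := by
  funext x
  rw [walshMul_apply, walshMul_apply, ← mul_assoc, walsh_mul_self, one_mul]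

/-- **Bipartiteness**: `B (W v) = - W (B v)` — every edge in an `S₀`-direction changes the parity
of the `S₀`-coordinates. [cite: AaronsonBenDavidKothariRaoTal2021, §3 (G_f is bipartite)] -/
theorem huangOp_walshMul (S₀ : Finset (Fin N)) (v : (Fin N → Bool) → ℝ) :
    huangOp S₀ (walshMul S₀ v) = -walshMul S₀ (huangOp S₀ v) := by
  funext x
  simp only [huangOp_apply, walshMul_apply, Pi.neg_apply, Finset.mul_sum, ← Finset.sum_neg_distrib]
  refine Finset.sum_congr rfl fun i hi => ?_
  rw [walsh_flipBlock_singleton_of_mem hi]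
  ring

/-! ### The eigenspaces of `B` -/

/-- The `+√n`-eigenspace of `B` (Mathlib's `Module.End.eigenspace`). [cite: Huang2019, Lemma 2.2] -/
abbrev eigPlus (S₀ : Finset (Fin N)) : Submodule ℝ ((Fin N → Bool) → ℝ) :=
  Module.End.eigenspace (huangOp S₀) (Real.sqrt S₀.card)

/-- The `-√n`-eigenspace of `B` (Mathlib's `Module.End.eigenspace`). [cite: Huang2019, Lemma 2.2] -/
abbrev eigMinus (S₀ : Finset (Fin N)) : Submodule ℝ ((Fin N → Bool) → ℝ) :=
  Module.End.eigenspace (huangOp S₀) (-Real.sqrt S₀.card)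

/-- Membership in `eigPlus` (`Module.End.mem_eigenspace_iff`). [folklore] -/
theorem mem_eigPlus {S₀ : Finset (Fin N)} {v : (Fin N → Bool) → ℝ} :
    v ∈ eigPlus S₀ ↔ huangOp S₀ v = Real.sqrt S₀.card • v :=
  Module.End.mem_eigenspace_iff

/-- Membership in `eigMinus` (`Module.End.mem_eigenspace_iff`). [folklore] -/
theorem mem_eigMinus {S₀ : Finset (Fin N)} {v : (Fin N → Bool) → ℝ} :
    v ∈ eigMinus S₀ ↔ huangOp S₀ v = -(Real.sqrt S₀.card • v) := by
  rw [Module.End.mem_eigenspace_iff, neg_smul]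

/-- `√n ≠ 0` for nonempty `S₀`. [folklore] -/
theorem sqrt_card_pos {S₀ : Finset (Fin N)} (hS : S₀.Nonempty) : 0 < Real.sqrt S₀.card :=
  Real.sqrt_pos.mpr (by exact_mod_cast Finset.card_pos.mpr hS)

/-- The two eigenspaces meet trivially. [cite: Huang2019, Lemma 2.2] -/
theorem eigPlus_inf_eigMinus {S₀ : Finset (Fin N)} (hS : S₀.Nonempty) :
    eigPlus S₀ ⊓ eigMinus S₀ = ⊥ := by
  rw [Submodule.eq_bot_iff]
  intro v hv
  obtain ⟨h1, h2⟩ := Submodule.mem_inf.mp hv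
  rw [mem_eigPlus] at h1
  rw [mem_eigMinus] at h2
  have h : (2 * Real.sqrt S₀.card) • v = 0 := by
    rw [mul_smul, two_smul]
    nth_rw 1 [← h1]
    rw [h2, neg_add_cancel]
  exact (smul_eq_zero.mp h).resolve_left (by positivity [sqrt_card_pos hS])

/-- The two eigenspaces span everything: `v = ½(v + Bv/√n) + ½(v - Bv/√n)` (all eigenvalues are
`±√n` since `B² = nI`). [cite: Huang2019, Lemma 2.2] -/
theorem eigPlus_sup_eigMinus {S₀ : Finset (Fin N)} (hS : S₀.Nonempty) :
    eigPlus S₀ ⊔ eigMinus S₀ = ⊤ := by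
  rw [Submodule.eq_top_iff']
  intro v
  set r := Real.sqrt S₀.card with hr
  have hr0 : r ≠ 0 := (sqrt_card_pos hS).ne'
  have hrr : r * r = S₀.card := by
    rw [hr, Real.mul_self_sqrt (by positivity)]
  have hBB := huangOp_huangOp S₀ v
  set u := huangOp S₀ v with hu
  refine Submodule.mem_sup.mpr ⟨(1 / 2 : ℝ) • (v + r⁻¹ • u), ?_,
    (1 / 2 : ℝ) • (v - r⁻¹ • u), ?_, ?_⟩
  · rw [mem_eigPlus, ← hr, map_smul, map_add, map_smul, ← hu, hBB, ← hrr, smul_smul r⁻¹,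
      inv_mul_cancel_left₀ hr0, smul_comm r (1 / 2 : ℝ)]
    congr 1
    rw [smul_add, smul_smul, mul_inv_cancel₀ hr0, one_smul, add_comm]
  · rw [mem_eigMinus, ← hr, map_smul, map_sub, map_smul, ← hu, hBB, ← hrr, smul_smul r⁻¹,
      inv_mul_cancel_left₀ hr0, smul_comm r (1 / 2 : ℝ), ← smul_neg]
    congr 1
    rw [smul_sub, smul_smul, mul_inv_cancel₀ hr0, one_smul, neg_sub]
  · rw [← smul_add]
    have : v + r⁻¹ • u + (v - r⁻¹ • u) = (2 : ℝ) • v := by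
      rw [two_smul]; abel
    rw [this, smul_smul]
    norm_num

/-- `W` maps the `+√n`-eigenspace isomorphically onto the `-√n`-eigenspace (so the two have the
same dimension — the tree's form of "the trace of `B_n` is `0`"). [cite: Huang2019, Lemma 2.2] -/
def eigPlusEquivEigMinus (S₀ : Finset (Fin N)) : eigPlus S₀ ≃ₗ[ℝ] eigMinus S₀ where
  toFun v := ⟨walshMul S₀ v.1, by
    rw [mem_eigMinus, huangOp_walshMul, mem_eigPlus.mp v.2, map_smul]⟩
  invFun v := ⟨walshMul S₀ v.1, by
    rw [mem_eigPlus, huangOp_walshMul, mem_eigMinus.mp v.2, map_neg, map_smul, neg_neg]⟩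
  map_add' u v := by ext1; exact map_add _ _ _
  map_smul' c v := by ext1; exact map_smul _ _ _
  left_inv v := by ext1; exact walshMul_walshMul S₀ v.1
  right_inv v := by ext1; exact walshMul_walshMul S₀ v.1

/-- The cube has `2ᴺ` points, so the function space has dimension `2ᴺ`. [folklore] -/
theorem finrank_cube_fun : finrank ℝ ((Fin N → Bool) → ℝ) = 2 ^ N := by
  rw [Module.finrank_fintype_fun_eq_card, Fintype.card_fun, Fintype.card_bool, Fintype.card_fin]

/-- **Half of the eigenvalues are `+√n`**: `dim eigPlus = 2^{N-1}` ("`A_n` has exactly half of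
the eigenvalues being `√n`"). [cite: Huang2019, Lemma 2.2] -/
theorem finrank_eigPlus {S₀ : Finset (Fin N)} (hS : S₀.Nonempty) :
    finrank ℝ (eigPlus S₀) = 2 ^ (N - 1) := by
  have hN : 1 ≤ N := by
    obtain ⟨i, -⟩ := hS
    exact i.pos
  have h := Submodule.finrank_sup_add_finrank_inf_eq (eigPlus S₀) (eigMinus S₀)
  rw [eigPlus_sup_eigMinus hS, eigPlus_inf_eigMinus hS, finrank_top, finrank_bot,
    finrank_cube_fun, ← (eigPlusEquivEigMinus S₀).finrank_eq, add_zero] at h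
  have h2 : 2 ^ N = 2 * 2 ^ (N - 1) := by
    rw [← pow_succ']; congr 1; omega
  omega

/-! ### Functions supported in a set, and the eigenvector lemma -/

/-- The space of functions vanishing off `V`, as the range of Mathlib's extension-by-zero map
`Function.ExtendByZero.linearMap ℝ Subtype.val` from `V → ℝ`, has dimension `|V|`. [folklore] -/
theorem finrank_range_extendByZero (V : Finset (Fin N → Bool)) :
    finrank ℝ (LinearMap.range
      (Function.ExtendByZero.linearMap ℝ (Subtype.val : {x // x ∈ V} → (Fin N → Bool)))) =
      V.card := by
  rw [LinearMap.finrank_range_of_inj, Module.finrank_fintype_fun_eq_card, Fintype.card_coe]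
  intro u u' h
  change Function.extend Subtype.val u 0 = Function.extend Subtype.val u' 0 at h
  exact Function.extend_injective Subtype.val_injective (0 : (Fin N → Bool) → ℝ) h

/-- Functions in the range of the extension-by-zero map vanish off `V`. [folklore] -/
theorem apply_eq_zero_of_mem_range_extendByZero {V : Finset (Fin N → Bool)}
    {v : (Fin N → Bool) → ℝ} (hv : v ∈ LinearMap.range
      (Function.ExtendByZero.linearMap ℝ (Subtype.val : {x // x ∈ V} → (Fin N → Bool))))
    {x : Fin N → Bool} (hx : x ∉ V) : v x = 0 := by
  obtain ⟨u, rfl⟩ := LinearMap.mem_range.mp hv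
  change Function.extend Subtype.val u 0 x = 0
  rw [Function.extend_apply' _ _ _ fun ⟨a, ha⟩ => hx (ha ▸ a.2)]
  rfl

/-- **The eigenvector lemma** (ABKRT's dimension-count form of Huang's argument; here `V` is
their larger class `V₀`, `|V₀| ≥ 2^{n-1} + 1`, and "vanishes on `V₁`" is "supported in `V`"): if
`|V| > 2^{N-1}` and `S₀ ≠ ∅`, there is a nonzero `v` supported in `V` with `B v = √|S₀| · v` ("the
subspace of eigenvectors for `B_n` with eigenvalue `√n` is of dimension `2ⁿ/2`. Using
`|V₁| < 2ⁿ/2`, there must exist a nonzero eigenvector for `B_n` with eigenvalue `√n` that vanishes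
on `V₁`"; cf. Huang 2019, proof of Thm. 1.1, which uses Cauchy interlacing instead). [cite:
AaronsonBenDavidKothariRaoTal2021, §3 (proof of Thm. "Huang")] -/
theorem exists_eigenvector_vanishing_off {S₀ : Finset (Fin N)} (hS : S₀.Nonempty)
    (V : Finset (Fin N → Bool)) (hV : 2 ^ (N - 1) < V.card) :
    ∃ v : (Fin N → Bool) → ℝ, v ≠ 0 ∧ (∀ x, x ∉ V → v x = 0) ∧
      huangOp S₀ v = Real.sqrt S₀.card • v := by
  set Z := LinearMap.range
    (Function.ExtendByZero.linearMap ℝ (Subtype.val : {x // x ∈ V} → (Fin N → Bool))) with hZ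
  have hsum := Submodule.finrank_sup_add_finrank_inf_eq (eigPlus S₀) Z
  rw [finrank_eigPlus hS, hZ, finrank_range_extendByZero] at hsum
  have hle : finrank ℝ ↥(eigPlus S₀ ⊔ Z) ≤ 2 ^ N := by
    rw [← finrank_cube_fun (N := N)]; exact Submodule.finrank_le _
  rw [hZ] at hle
  have hN : 1 ≤ N := by
    obtain ⟨i, -⟩ := hS
    exact i.pos
  have h2 : 2 ^ N = 2 * 2 ^ (N - 1) := by
    rw [← pow_succ']; congr 1; omega
  have hpos : 0 < finrank ℝ ↥(eigPlus S₀ ⊓ LinearMap.range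
      (Function.ExtendByZero.linearMap ℝ (Subtype.val : {x // x ∈ V} → (Fin N → Bool)))) := by
    omega
  obtain ⟨w, hw⟩ := (Module.finrank_pos_iff_exists_ne_zero (R := ℝ)).mp hpos
  refine ⟨w.1, fun h => hw (Subtype.ext h), fun x hx => ?_, mem_eigPlus.mp w.2.1⟩
  exact apply_eq_zero_of_mem_range_extendByZero w.2.2 hx

end Literature.Computability.Complexity

end
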